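import Literature.NumberTheory.GaloisRepresentations.IdeleClassGroupLimitLayers
import HarnessLib

/-!
# Systems of Galois modules over the finite Galois layers `E ⊆ F̄` of a number field and their direct limits as
# discrete `Γ_F`-modules (Tate, C–F VII §9.7, §11.1; Serre, *Galois Cohomology* I §2.2; Harari §4.2, §13.1)

Topic `NumberTheory/GaloisRepresentations`; namespace `Literature.NumberTheory.GaloisRepresentations`
(structure `GalLayerSystem`, auxiliary statements in `IdeleClassBar.GalLayer`).  Definitions with bodies and theorems;
NO named fact, no `sorry`, no instance, no notation.  Written for Route A of the Poitou–Tate programme of crux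
`AnticycControlAdditiveK` (cell bsd-schneider, item 19295): the three limit modules `lim→ Eˣ = F̄ˣ`, `J̄ = lim→ J_E`,
`C̄ = lim→ C_E` of the idèle class formation (Tate VII §9.7 `J_{K̄} = lim J_L`; §11.1 passage to the limit over the
finite layers `E ⊆ K̄`; Harari §13.1 `I = lim→ I_K`, `C = lim→ C_K`) are all instances of ONE construction, done here
once: door-c5 g15 did `C̄` by hand (`IdeleClassGroupLimit*.lean`); this file abstracts that construction so that `J̄`
and `lim→ Eˣ`, the maps between them and the exactness of `0 → F̄ˣ → J̄ → C̄ → 0` come for free (sequel files).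

A **Galois layer system** `S` over `F` (`GalLayerSystem F`) is: for every finite Galois layer `E ⊆ F̄`
(`IdeleClassBar.GalLayer F`) an integral representation `S.obj E` of `Gal(E/F)`, and for `E ≤ E'` an injective additive
BASE CHANGE `S.base h : S.obj E → S.obj E'`, transitive (`base_base`), equivariant for `Γ_F` acting through
`σ ↦ σ|_E` (`base_ρ`), and satisfying GALOIS DESCENT (`descent`: an element of `S.obj M` fixed by `Gal(F̄/E)`, `E ≤ M`,
is a base change from `E`) — Tate VII §8 Prop. 8.1 / Neukirch III (2.5)–(2.7) for `J` and `C`, Galois theory for `Eˣ`.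
Nothing is ASSUMED about `S.base` at `E = E`: that it is the identity FOLLOWS from injectivity and transitivity
(`base_self`; so the case distinction of g15's `transHom` is unnecessary — for idèle classes this proves that the base change
of `C_E` along the tautological algebra `E → E` is the identity, a statement g15 left open).

## What is formalised (`F : Type` a field / number field, `Γ = absoluteGaloisGroup F`)

* §0 `GalLayer.restrictHom E : Γ →* Gal(E/F)` (`σ ↦ σ|_E`; `_apply`, `_surjective`, `_eq_one_of_mem`,
  `restrictHom_restrictHom` for `E ≤ E'`, `quotEquiv_symm_restrictHom`).
* §1 the structure **`GalLayerSystem F`**; **`base_self`** (`S.base (le_refl E) = id`), `S.trans` (= `S.base`, explicit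
  layers), `directedSystem`, **`S.limit = lim→_E S.obj E`** (Mathlib `AddCommGroup.DirectLimit`), `S.of E` (+ `of_base`,
  **`exists_of`**, **`of_injective`**, `of_eq_of_iff`).
* §2 the action: `S.layerAct`, `base_layerAct`, `S.act σ`, **`S.rep : Representation ℤ Γ S.limit`** (+ `rep_of`),
  `rep_of_of_mem` (`Gal(F̄/E)` fixes the image of `S.obj E`), **`S.toRep : Rep ℤ Γ`**, **`S.isDiscrete`**,
  **`S.toD : DiscreteRepCat ℤ Γ`** (door-c4's `C_Γ`).
* §3 descent in the limit: **`exists_of_eq_of_forall_mem`** (`(lim S)^{Gal(F̄/E)} = S.obj E`),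
  `setOf_forall_mem_eq_range`.

Layers `(lim S)^{U_E} ≅ S.obj E` as `Γ⧸U_E`-representations, their cohomology and the inflations: sequel
`GalLayerSystemLayers.lean`; the instances `Eˣ`, `J_E`, `C_E` and the short exact sequence: `GalLayerSystemIdele.lean`.

## References
* J. W. S. Cassels, A. Fröhlich (eds.), *Algebraic Number Theory* (1967), Ch. VII (J. Tate) §8 Prop. 8.1, §9.7, §11.1.
  [CasselsFrohlichANT1967]
* J.-P. Serre, *Galois Cohomology*, Springer (1997), I §2.2. [SerreGaloisCohomology1997]
* D. Harari, *Galois Cohomology and Class Field Theory* (2020), §4.2, §13.1. [Harari2020]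
* J. Neukirch, *Class Field Theory — The Bonn Lectures* (2013), Part III §2 (2.5)–(2.7). [Neukirch2013]
-/

noncomputable section

open CategoryTheory
open Field (absoluteGaloisGroup)
open Literature.Algebra.Homology
open scoped Classical

namespace Literature.NumberTheory.GaloisRepresentations

namespace IdeleClassBar

namespace GalLayer

variable {F : Type} [Field F]

/-! ## §0. `σ ↦ σ|_E` -/

/-- **`Γ_F → Gal(E/F)`, `σ ↦ σ|_E`** for a layer `E` (Mathlib `AlgEquiv.restrictNormalHom`).
[cite: SerreGaloisCohomology1997, I §2.2] -/
def restrictHom (E : GalLayer F) : absoluteGaloisGroup F →* (E.1 ≃ₐ[F] E.1) :=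
  haveI := E.isGalois
  AlgEquiv.restrictNormalHom E.1

/-- `restrictHom E σ = σ|_E`. [cite: SerreGaloisCohomology1997, I §2.2] -/
theorem restrictHom_apply (E : GalLayer F) (σ : absoluteGaloisGroup F) :
    E.restrictHom σ = (haveI := E.isGalois; σ.restrictNormal E.1) := rfl

/-- `σ ↦ σ|_E` is onto. [cite: SerreGaloisCohomology1997, I §2.2] -/
theorem restrictHom_surjective (E : GalLayer F) : Function.Surjective E.restrictHom :=
  haveI := E.isGalois
  AlgEquiv.restrictNormalHom_surjective (F := F) (K₁ := E.1) (E := AlgebraicClosure F)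

/-- `σ|_E = 1` for `σ ∈ U_E = Gal(F̄/E)`. [cite: SerreGaloisCohomology1997, I §2.2] -/
theorem restrictHom_eq_one_of_mem (E : GalLayer F) {σ : absoluteGaloisGroup F} (hσ : σ ∈ E.openNormalSubgroup) :
    E.restrictHom σ = 1 :=
  restrictNormal_eq_one_of_mem_fixingSubgroup E hσ

/-- `(σ|_{E'})|_E = σ|_E` for `E ≤ E'`. [cite: SerreGaloisCohomology1997, I §2.2] -/
theorem restrictHom_restrictHom {E E' : GalLayer F} (h : E ≤ E') (σ : absoluteGaloisGroup F) :
    (haveI := E.isGalois; letI := algebraOfLE h; haveI := isScalarTower_of_le h;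
      (E'.restrictHom σ).restrictNormal E.1) = E.restrictHom σ :=
  restrictNormal_restrictNormal h σ

/-- `quotEquiv [σ] = restrictHom E σ`. [cite: SerreGaloisCohomology1997, I §2.2] -/
theorem quotEquiv_mk_eq_restrictHom [NumberField F] (E : GalLayer F) (σ : absoluteGaloisGroup F) :
    E.quotEquiv (QuotientGroup.mk σ) = E.restrictHom σ := rfl

/-- `quotEquiv⁻¹ (σ|_E) = [σ]`. [cite: SerreGaloisCohomology1997, I §2.2] -/
theorem quotEquiv_symm_restrictHom [NumberField F] (E : GalLayer F) (σ : absoluteGaloisGroup F) :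
    E.quotEquiv.symm (E.restrictHom σ) = QuotientGroup.mk σ :=
  quotEquiv_symm_restrictNormal E σ

end GalLayer

end IdeleClassBar

open IdeleClassBar

/-! ## §1. Galois layer systems and their direct limits -/

/-- **A system of integral Galois representations over the finite Galois layers `E ⊆ F̄`**: modules `S.obj E` of
`Gal(E/F)` with injective, transitive, `Γ_F`-equivariant base changes `S.base h : S.obj E → S.obj E'` (`E ≤ E'`)
satisfying Galois descent (an element of `S.obj M` fixed by `Gal(F̄/E)` comes from `S.obj E`).  Instances: `E ↦ Eˣ`,
`E ↦ J_E` (Tate VII §8 Prop. 8.1), `E ↦ C_E` (Neukirch III (2.7)).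
[cite: CasselsFrohlichANT1967, Ch. VII §8 Prop. 8.1 and §9.7] -/
structure GalLayerSystem (F : Type) [Field F] where
  /-- The layer module, a representation of `Gal(E/F)`. -/
  obj (E : GalLayer F) : Rep.{0} ℤ (E.1 ≃ₐ[F] E.1)
  /-- The base change `S.obj E → S.obj E'` for `E ≤ E'`. -/
  base ⦃E E' : GalLayer F⦄ (h : E ≤ E') : (obj E).V →+ (obj E').V
  /-- Base changes compose. -/
  base_base ⦃E E' E'' : GalLayer F⦄ (h : E ≤ E') (h' : E' ≤ E'') (x : (obj E).V) :
    base h' (base h x) = base (h.trans h') x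
  /-- Base changes are injective. -/
  base_injective ⦃E E' : GalLayer F⦄ (h : E ≤ E') : Function.Injective (base h)
  /-- Base changes are `Γ_F`-equivariant (`Γ_F` acting on `S.obj E` through `σ ↦ σ|_E`). -/
  base_ρ ⦃E E' : GalLayer F⦄ (h : E ≤ E') (σ : absoluteGaloisGroup F) (x : (obj E).V) :
    base h ((obj E).ρ (E.restrictHom σ) x) = (obj E').ρ (E'.restrictHom σ) (base h x)
  /-- Galois descent: an element of `S.obj M` fixed by `Gal(F̄/E)`, `E ≤ M`, is a base change from `E`. -/
  descent ⦃E M : GalLayer F⦄ (h : E ≤ M) (y : (obj M).V)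
    (hy : ∀ σ ∈ E.openNormalSubgroup, (obj M).ρ (M.restrictHom σ) y = y) : ∃ x : (obj E).V, base h x = y

namespace GalLayerSystem

variable {F : Type} [Field F] (S : GalLayerSystem F)

/-- The underlying abelian group of the layer `S.obj E` (the family of the direct limit). [cite: Harari2020, §13.1] -/
abbrev objV (E : GalLayer F) : Type := (S.obj E).V

/-- **The base change from a layer to itself is the identity** — a CONSEQUENCE of injectivity and transitivity
(`base h (base h x) = base h x`), so no axiom about `E = E` is needed. [cite: Harari2020, §13.1] -/
theorem base_self {E : GalLayer F} (h : E ≤ E) (x : (S.obj E).V) : S.base h x = x :=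
  S.base_injective h (S.base_base h h x)

/-- The transition maps of the directed system, with explicit layers (`= S.base`). [cite: Harari2020, §13.1] -/
abbrev trans (E E' : GalLayer F) (h : E ≤ E') : S.objV E →+ S.objV E' := S.base h

/-- The directed-system axioms for `(S.obj E, S.base)` (as a theorem; used through `haveI`). [cite: Harari2020, §13.1] -/
theorem directedSystem : DirectedSystem S.objV (fun E E' h => S.trans E E' h) :=
  ⟨fun _ x => S.base_self le_rfl x, fun _ _ _ h h' x => S.base_base h h' x⟩

/-- **The direct limit `lim→_E S.obj E`** over the finite Galois layers, additively (Mathlib's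
`AddCommGroup.DirectLimit`). [cite: Harari2020, §13.1][cite: CasselsFrohlichANT1967, Ch. VII §9.7] -/
abbrev limit : Type := AddCommGroup.DirectLimit S.objV S.trans

/-- **The canonical map `S.obj E → lim S`.** [cite: Harari2020, §13.1] -/
def of (E : GalLayer F) : (S.obj E).V →+ S.limit :=
  AddCommGroup.DirectLimit.of S.objV S.trans E

/-- `S.obj E → S.obj E' → lim S` is `S.obj E → lim S`. [cite: Harari2020, §13.1] -/
theorem of_base {E E' : GalLayer F} (h : E ≤ E') (x : (S.obj E).V) : S.of E' (S.base h x) = S.of E x := by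
  unfold of
  exact AddCommGroup.DirectLimit.of_f (G := S.objV) (f := S.trans) h x

/-- **Every element of `lim S` comes from some layer.** [cite: Harari2020, §13.1] -/
theorem exists_of (z : S.limit) : ∃ (E : GalLayer F) (x : (S.obj E).V), S.of E x = z := by
  haveI := GalLayer.nonempty F
  haveI := GalLayer.isDirectedOrder F
  induction z using AddCommGroup.DirectLimit.induction_on with
  | ih E x => exact ⟨E, x, rfl⟩

/-- **`S.obj E → lim S` is injective** (the transition maps are injective). [cite: Harari2020, §13.1] -/
theorem of_injective (E : GalLayer F) : Function.Injective (S.of E) := by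
  haveI := GalLayer.nonempty F
  haveI := GalLayer.isDirectedOrder F
  haveI := S.directedSystem
  refine (injective_iff_map_eq_zero _).2 fun x hx => ?_
  unfold of at hx
  obtain ⟨E', h, h0⟩ := AddCommGroup.DirectLimit.of.zero_exact (G := S.objV) (f := S.trans) E x hx
  exact S.base_injective h (h0.trans (map_zero _).symm)

/-- Two elements of layers agree in `lim S` iff they agree in a common bigger layer. [cite: Harari2020, §13.1] -/
theorem of_eq_of_iff {E E' : GalLayer F} (x : (S.obj E).V) (y : (S.obj E').V) :
    S.of E x = S.of E' y ↔ ∃ (M : GalLayer F) (h : E ≤ M) (h' : E' ≤ M), S.base h x = S.base h' y := by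
  constructor
  · intro hxy
    obtain ⟨M, h, h'⟩ := GalLayer.exists_ge_ge E E'
    refine ⟨M, h, h', S.of_injective M ?_⟩
    rw [of_base, of_base, hxy]
  · rintro ⟨M, h, h', hM⟩
    rw [← S.of_base h, ← S.of_base h', hM]

/-! ## §2. The action of `Γ_F` on `lim S`; discreteness -/

/-- **The action of `σ ∈ Γ_F` on the layer `S.obj E`**, through `σ ↦ σ|_E`. [cite: Harari2020, §13.1] -/
def layerAct (E : GalLayer F) (σ : absoluteGaloisGroup F) : (S.obj E).V →+ (S.obj E).V :=
  AddMonoidHom.mk' (fun x => (S.obj E).ρ (E.restrictHom σ) x) fun x y => map_add _ x y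

/-- Formula. [cite: Harari2020, §13.1] -/
theorem layerAct_apply (E : GalLayer F) (σ : absoluteGaloisGroup F) (x : (S.obj E).V) :
    S.layerAct E σ x = (S.obj E).ρ (E.restrictHom σ) x := rfl

/-- `layerAct E 1 = id`. [cite: Harari2020, §13.1] -/
theorem layerAct_one (E : GalLayer F) (x : (S.obj E).V) : S.layerAct E 1 x = x := by
  rw [layerAct_apply, map_one, (S.obj E).ρ.map_one]
  rfl

/-- `layerAct E (σ τ) = layerAct E σ ∘ layerAct E τ`. [cite: Harari2020, §13.1] -/
theorem layerAct_mul (E : GalLayer F) (σ τ : absoluteGaloisGroup F) (x : (S.obj E).V) :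
    S.layerAct E (σ * τ) x = S.layerAct E σ (S.layerAct E τ x) := by
  simp only [layerAct_apply, map_mul, Module.End.mul_apply]

/-- **The layer actions are compatible with the base changes.** [cite: CasselsFrohlichANT1967, Ch. VII §1.1] -/
theorem base_layerAct {E E' : GalLayer F} (h : E ≤ E') (σ : absoluteGaloisGroup F) (x : (S.obj E).V) :
    S.base h (S.layerAct E σ x) = S.layerAct E' σ (S.base h x) :=
  S.base_ρ h σ x

/-- **The action of `σ ∈ Γ_F` on `lim S`** (the limit of the layer actions). [cite: Harari2020, §13.1] -/
def act (σ : absoluteGaloisGroup F) : S.limit →+ S.limit :=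
  AddCommGroup.DirectLimit.map (fun E => S.layerAct E σ) fun _ _ h =>
    AddMonoidHom.ext fun x => (S.base_layerAct h σ x).symm

/-- `σ • [x]_E = [σ|_E • x]_E`. [cite: Harari2020, §13.1] -/
theorem act_of (σ : absoluteGaloisGroup F) (E : GalLayer F) (x : (S.obj E).V) :
    S.act σ (S.of E x) = S.of E (S.layerAct E σ x) := by
  unfold act of
  rw [AddCommGroup.DirectLimit.map_apply_of]

/-- `1` acts trivially. [cite: Harari2020, §13.1] -/
theorem act_one (z : S.limit) : S.act 1 z = z := by
  obtain ⟨E, x, rfl⟩ := S.exists_of z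
  rw [act_of, layerAct_one]

/-- `(σ τ) • z = σ • (τ • z)`. [cite: Harari2020, §13.1] -/
theorem act_mul (σ τ : absoluteGaloisGroup F) (z : S.limit) : S.act (σ * τ) z = S.act σ (S.act τ z) := by
  obtain ⟨E, x, rfl⟩ := S.exists_of z
  rw [act_of, act_of, act_of, layerAct_mul]

/-- **`lim S` as a `ℤ`-linear representation of `Γ_F`.** [cite: Harari2020, §13.1] -/
def rep : Representation ℤ (absoluteGaloisGroup F) S.limit where
  toFun σ := (S.act σ).toIntLinearMap
  map_one' := LinearMap.ext fun z => S.act_one z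
  map_mul' σ τ := LinearMap.ext fun z => S.act_mul σ τ z

/-- Formula: `S.rep σ z = S.act σ z`. [cite: Harari2020, §13.1] -/
@[simp] theorem rep_apply (σ : absoluteGaloisGroup F) (z : S.limit) : S.rep σ z = S.act σ z := rfl

/-- `S.rep σ [x]_E = [σ|_E • x]_E`. [cite: Harari2020, §13.1] -/
theorem rep_of (σ : absoluteGaloisGroup F) (E : GalLayer F) (x : (S.obj E).V) :
    S.rep σ (S.of E x) = S.of E ((S.obj E).ρ (E.restrictHom σ) x) :=
  S.act_of σ E x

/-- `Gal(F̄/E)` fixes the image of `S.obj E`. [cite: Harari2020, §13.1] -/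
theorem rep_of_of_mem (E : GalLayer F) {σ : absoluteGaloisGroup F} (hσ : σ ∈ E.openNormalSubgroup)
    (x : (S.obj E).V) : S.rep σ (S.of E x) = S.of E x := by
  rw [rep_of, GalLayer.restrictHom_eq_one_of_mem E hσ, (S.obj E).ρ.map_one]
  rfl

/-- **`lim S` as an object of `Rep ℤ Γ_F`.** [cite: Harari2020, §4.2 and §13.1] -/
abbrev toRep : Rep ℤ (absoluteGaloisGroup F) := Rep.of S.rep

/-- `Gal(F̄/E) ≤ Stab([x]_E)`. [cite: Harari2020, §4.2 Remark 4.13] -/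
theorem openNormalSubgroup_le_stabilizer_of (E : GalLayer F) (x : (S.obj E).V) :
    (E.openNormalSubgroup : Subgroup (absoluteGaloisGroup F)) ≤ DiscreteRep.stabilizer S.toRep (S.of E x) :=
  fun _ hσ => S.rep_of_of_mem E hσ x

/-- **`lim S` is a discrete `Γ_F`-module**: every stabiliser contains an open subgroup `Gal(F̄/E)`.
[cite: Harari2020, §4.2 Remark 4.13 and §13.1] -/
theorem isDiscrete : DiscreteRep.IsDiscrete S.toRep := fun z => by
  obtain ⟨E, x, rfl⟩ := S.exists_of z
  exact Subgroup.isOpen_mono (S.openNormalSubgroup_le_stabilizer_of E x) E.openNormalSubgroup.toOpenSubgroup.isOpen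

/-- **`lim S` as an object of `C_Γ = DiscreteRepCat ℤ Γ_F`.** [cite: Harari2020, §4.2 and §13.1] -/
abbrev toD : DiscreteRepCat ℤ (absoluteGaloisGroup F) := DiscreteRep.mk S.toRep S.isDiscrete

/-! ## §3. Descent in the limit: `(lim S)^{Gal(F̄/E)} = S.obj E` -/

/-- **`H⁰(Gal(F̄/E), lim S) = S.obj E`**: an element of `lim S` fixed by `Gal(F̄/E)` lies in the image of `S.obj E`
(and conversely, `rep_of_of_mem`).  Proof: it comes from a layer `M ≥ E`, where it is fixed by `Gal(F̄/E)` acting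
through `σ ↦ σ|_M` (`of_injective`), hence descends (`S.descent`).
[cite: CasselsFrohlichANT1967, Ch. VII §8 Prop. 8.1][cite: Harari2020, §13.1] -/
theorem exists_of_eq_of_forall_mem (E : GalLayer F) (z : S.limit)
    (hz : ∀ σ ∈ E.openNormalSubgroup, S.rep σ z = z) : ∃ x : (S.obj E).V, S.of E x = z := by
  obtain ⟨M₀, y₀, rfl⟩ := S.exists_of z
  obtain ⟨M, h, h₀⟩ := GalLayer.exists_ge_ge E M₀
  set y : (S.obj M).V := S.base h₀ y₀ with hy_def
  have hyz : S.of M y = S.of M₀ y₀ := S.of_base h₀ y₀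
  have hy : ∀ σ ∈ E.openNormalSubgroup, (S.obj M).ρ (M.restrictHom σ) y = y := by
    intro σ hσ
    have h1 := hz σ hσ
    rw [← hyz, rep_of] at h1
    exact S.of_injective M h1
  obtain ⟨x, hx⟩ := S.descent h y hy
  exact ⟨x, by rw [← hyz, ← hx, of_base]⟩

/-- **`(lim S)^{Gal(F̄/E)} = S.obj E`** as an equality of sets. [cite: Harari2020, §13.1] -/
theorem setOf_forall_mem_eq_range (E : GalLayer F) :
    {z : S.limit | ∀ σ ∈ E.openNormalSubgroup, S.rep σ z = z} = Set.range (S.of E) := by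
  ext z
  constructor
  · intro hz
    obtain ⟨x, hx⟩ := S.exists_of_eq_of_forall_mem E z hz
    exact ⟨x, hx⟩
  · rintro ⟨x, rfl⟩ σ hσ
    exact S.rep_of_of_mem E hσ x

/-- **`(lim S)^{Γ_F} = S.obj F`**: the `Γ_F`-invariants are the image of the bottom layer (`U_⊥ = Γ_F`).
[cite: Harari2020, §13.1] -/
theorem setOf_forall_eq_range_bot :
    {z : S.limit | ∀ σ : absoluteGaloisGroup F, S.rep σ z = z} = Set.range (S.of (GalLayer.bot F)) := by
  rw [← setOf_forall_mem_eq_range]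
  ext z
  simp only [Set.mem_setOf_eq]
  constructor
  · exact fun hz σ _ => hz σ
  · intro hz σ
    refine hz σ ((IntermediateField.mem_fixingSubgroup_iff _ _).2 fun x hx => ?_)
    obtain ⟨a, rfl⟩ := IntermediateField.mem_bot.1 hx
    exact σ.commutes a

end GalLayerSystem

end Literature.NumberTheory.GaloisRepresentations

end
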